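import Mathlib
import HarnessLib

/-!
# Closed-loop variation of constants for a slaved `2 × 2` linear system: the monodromy (loop) estimate

Topic `Analysis/ODE`. An elementary but effective a-priori estimate for a linear system in triangular-interaction
("Levinson", slaved-gauge) form along a real parameter interval `[0, T]`,
  `g′ = a g − f υ`,   `υ′ = α (g + ρ υ)`,
when the parameter interval is a CLOSED LOOP for the unknowns (`g T = g 0`) while the integrating factor is NOT closed: the
real part of the primitive `A` of `a` is non-decreasing (`Re a ≥ 0`) and gains a large amount on an initial stretch `[0, s₁]`
(`Re a ≥ λ v`, `v` a speed, with `‖f‖ ≤ f₁ v` there). This is the situation of a solution of a linear ODE with a regular-singular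
point, holomorphic (single-valued) around the singular point, transported around a loop in the complex domain on which the
exponent `∫ a` has large positive real part (contour deformation into the half-plane where the transport kernel is suppressed):
the boundary terms of the variation-of-constants formula cancel against the monodromy factor `e^{−A(T)}`, and one obtains bounds
with NO information on the solution other than single-valuedness:

* `intFactor_identity` — `e^{−A σ₂} g σ₂ − e^{−A σ₁} g σ₁ = ∫_{σ₁}^{σ₂} e^{−A} F` for `g′ = a g + F`, `A′ = a`;
* `norm_base_le_of_loop` — THE LOOP ESTIMATE: `‖g 0‖ (1 − e^{−L₀}) ≤ f₁/λ + e^{−L₀} Φ` (`L₀ ≤ Re A(s₁)`, `Φ ≥ ∫_{s₁}^T ‖F‖`);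
* `norm_le_base_add_of_loop` — `‖g σ‖ ≤ ‖g 0‖ + ∫_σ^T ‖F‖` for every `σ` (transport in the contracting direction);
* `norm_sub_le_of_slow` — `‖υ σ − υ 0‖ ≤ (Γ + ϱ U) ∫₀^T ‖α‖` for the slow component;
* `loop_slaving_estimate` — the three combined for `F = −f υ`: with `c₁ = (f₁/λ + e^{−L₀} Φ)/(1 − e^{−L₀})` and
  `κ = A_α (c₁ + Φ_T + ϱ)`, every such pair satisfies `‖g 0‖ (1 − κ) ≤ c₁ ‖υ 0‖` — the "slaving" of `g` to `υ` at the base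
  point of the loop, with constants that see only coefficient bounds along the loop.

Everything is proved; no definitions, no named facts. Elementary (integrating factor + bookkeeping); the use of closed contours
against monodromy at a regular-singular point is classical (Coddington–Levinson 1955, Ch. 4; Olver 1974, Ch. 6), the packaged
inequality is folklore.
-/

noncomputable section

open Set Filter MeasureTheory intervalIntegral
open scoped Topology

namespace Literature.Analysis.ODE

/-! ## The integrating-factor identity -/

/-- **Integrating factor.** If `g′ = a g + F` and `A′ = a` on `[0, T]` (`F` continuous there), then for `0 ≤ σ₁ ≤ σ₂ ≤ T`:
`e^{−A σ₂} g σ₂ − e^{−A σ₁} g σ₁ = ∫_{σ₁}^{σ₂} e^{−A τ} F τ dτ`. [folklore] -/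
theorem intFactor_identity {T : ℝ} {g a F A : ℝ → ℂ} (hg : ∀ σ ∈ Icc 0 T, HasDerivAt g (a σ * g σ + F σ) σ)
    (hA : ∀ σ ∈ Icc 0 T, HasDerivAt A (a σ) σ) (hF : ContinuousOn F (Icc 0 T)) {σ₁ σ₂ : ℝ} (h₁ : 0 ≤ σ₁) (h₁₂ : σ₁ ≤ σ₂)
    (h₂ : σ₂ ≤ T) :
    Complex.exp (-A σ₂) * g σ₂ - Complex.exp (-A σ₁) * g σ₁ = ∫ τ in σ₁..σ₂, Complex.exp (-A τ) * F τ := by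
  have hsub : uIcc σ₁ σ₂ ⊆ Icc 0 T := by
    rw [uIcc_of_le h₁₂]; exact Icc_subset_Icc h₁ h₂
  have hderiv : ∀ τ ∈ uIcc σ₁ σ₂, HasDerivAt (fun τ => Complex.exp (-A τ) * g τ) (Complex.exp (-A τ) * F τ) τ := by
    intro τ hτ
    have hτ' := hsub hτ
    have hE : HasDerivAt (fun τ => Complex.exp (-A τ)) (Complex.exp (-A τ) * -a τ) τ := (hA τ hτ').neg.cexp
    refine (hE.mul (hg τ hτ')).congr_deriv ?_
    ring
  have hAc : ContinuousOn A (Icc 0 T) := fun τ hτ => (hA τ hτ).continuousAt.continuousWithinAt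
  have hint : IntervalIntegrable (fun τ => Complex.exp (-A τ) * F τ) volume σ₁ σ₂ :=
    (((hAc.mono hsub).neg.cexp).mul (hF.mono hsub)).intervalIntegrable
  rw [integral_eq_sub_of_hasDerivAt hderiv hint]

/-- The real part of the primitive has derivative `Re a`. [folklore] -/
theorem hasDerivAt_re_primitive {T : ℝ} {a A : ℝ → ℂ} (hA : ∀ σ ∈ Icc 0 T, HasDerivAt A (a σ) σ) {σ : ℝ}
    (hσ : σ ∈ Icc 0 T) : HasDerivAt (fun σ => (A σ).re) ((a σ).re) σ :=
  Complex.reCLM.hasFDerivAt.comp_hasDerivAt σ (hA σ hσ)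

/-- The real part of the primitive is non-decreasing when `Re a ≥ 0`. [folklore] -/
theorem monotoneOn_re_primitive {T : ℝ} {a A : ℝ → ℂ} (hA : ∀ σ ∈ Icc 0 T, HasDerivAt A (a σ) σ)
    (ha : ∀ σ ∈ Icc 0 T, 0 ≤ (a σ).re) : MonotoneOn (fun σ => (A σ).re) (Icc 0 T) := by
  refine monotoneOn_of_hasDerivWithinAt_nonneg (f' := fun σ => (a σ).re) (convex_Icc 0 T)
    (fun σ hσ => (hasDerivAt_re_primitive hA hσ).continuousAt.continuousWithinAt) (fun σ hσ => ?_) (fun σ hσ => ?_)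
  · rw [interior_Icc] at hσ ⊢
    exact (hasDerivAt_re_primitive hA (Ioo_subset_Icc_self hσ)).hasDerivWithinAt
  · rw [interior_Icc] at hσ
    exact ha σ (Ioo_subset_Icc_self hσ)

/-! ## The loop estimate for the fast (slaved) component -/

/-- The forcing integral on the steep initial stretch: if `Re a ≥ λ v` and `‖F‖ ≤ f₁ v` on `[0, s₁]` then
`∫₀^{s₁} e^{−Re A} ‖F‖ ≤ (f₁/λ)(e^{−Re A 0} − e^{−Re A s₁})` (compare with the derivative of `−(f₁/λ) e^{−Re A}`). [folklore] -/
theorem integral_steep_le {T s₁ lam f₁ : ℝ} {a F A : ℝ → ℂ} {v : ℝ → ℝ} (hA : ∀ σ ∈ Icc 0 T, HasDerivAt A (a σ) σ)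
    (hac : ContinuousOn a (Icc 0 T)) (hF : ContinuousOn F (Icc 0 T)) (hs₁ : s₁ ∈ Icc 0 T) (hlam : 0 < lam) (hf₁ : 0 ≤ f₁)
    (hv : ∀ σ ∈ Icc 0 s₁, lam * v σ ≤ (a σ).re) (hFv : ∀ σ ∈ Icc 0 s₁, ‖F σ‖ ≤ f₁ * v σ) :
    ∫ σ in (0 : ℝ)..s₁, Real.exp (-(A σ).re) * ‖F σ‖ ≤ (f₁ / lam) * (Real.exp (-(A 0).re) - Real.exp (-(A s₁).re)) := by
  have hsub : Icc 0 s₁ ⊆ Icc 0 T := Icc_subset_Icc le_rfl hs₁.2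
  have hAc : ContinuousOn A (Icc 0 T) := fun τ hτ => (hA τ hτ).continuousAt.continuousWithinAt
  have hReA : ContinuousOn (fun σ => (A σ).re) (Icc 0 T) := Complex.continuous_re.comp_continuousOn hAc
  have hRea : ContinuousOn (fun σ => (a σ).re) (Icc 0 T) := Complex.continuous_re.comp_continuousOn hac
  have hexpc : ContinuousOn (fun σ => Real.exp (-(A σ).re)) (Icc 0 T) := hReA.neg.rexp
  -- the comparison function and its derivative
  have hd : ∀ σ ∈ uIcc 0 s₁, HasDerivAt (fun σ => -(f₁ / lam) * Real.exp (-(A σ).re))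
      ((f₁ / lam) * (Real.exp (-(A σ).re) * (a σ).re)) σ := by
    intro σ hσ
    rw [uIcc_of_le hs₁.1] at hσ
    have h2 := ((hasDerivAt_re_primitive hA (hsub hσ)).neg.exp).const_mul (-(f₁ / lam))
    refine h2.congr_deriv ?_
    simp only [Pi.neg_apply]
    ring
  have hint : IntervalIntegrable (fun σ => (f₁ / lam) * (Real.exp (-(A σ).re) * (a σ).re)) volume 0 s₁ := by
    refine (ContinuousOn.intervalIntegrable ?_)
    rw [uIcc_of_le hs₁.1]
    exact ((hexpc.mul hRea).mono hsub).const_smul (f₁ / lam)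
  have hftc := integral_eq_sub_of_hasDerivAt hd hint
  -- pointwise comparison
  have hle : ∀ σ ∈ Icc 0 s₁, Real.exp (-(A σ).re) * ‖F σ‖ ≤ (f₁ / lam) * (Real.exp (-(A σ).re) * (a σ).re) := by
    intro σ hσ
    have hE := Real.exp_pos (-(A σ).re)
    calc Real.exp (-(A σ).re) * ‖F σ‖ ≤ Real.exp (-(A σ).re) * (f₁ * v σ) := mul_le_mul_of_nonneg_left (hFv σ hσ) hE.le
      _ = (f₁ / lam) * (Real.exp (-(A σ).re) * (lam * v σ)) := by field_simp
      _ ≤ (f₁ / lam) * (Real.exp (-(A σ).re) * (a σ).re) :=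
          mul_le_mul_of_nonneg_left (mul_le_mul_of_nonneg_left (hv σ hσ) hE.le) (div_nonneg hf₁ hlam.le)
  have hint0 : IntervalIntegrable (fun σ => Real.exp (-(A σ).re) * ‖F σ‖) volume 0 s₁ := by
    refine (ContinuousOn.intervalIntegrable ?_)
    rw [uIcc_of_le hs₁.1]
    exact (hexpc.mul hF.norm).mono hsub
  calc ∫ σ in (0 : ℝ)..s₁, Real.exp (-(A σ).re) * ‖F σ‖
      ≤ ∫ σ in (0 : ℝ)..s₁, (f₁ / lam) * (Real.exp (-(A σ).re) * (a σ).re) := integral_mono_on hs₁.1 hint0 hint hle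
    _ = (f₁ / lam) * (Real.exp (-(A 0).re) - Real.exp (-(A s₁).re)) := by rw [hftc]; ring

/-- **THE LOOP ESTIMATE.** Let `g′ = a g + F`, `A′ = a` on `[0, T]` (`a`, `F` continuous) with `A 0 = 0`, `Re a ≥ 0`, and the loop
condition `g T = g 0`. Suppose that on the initial stretch `[0, s₁]` the exponent grows at least at speed `λ v` while `‖F‖ ≤ f₁ v`,
that `L₀ ≤ Re A(s₁)`, and that `∫_{s₁}^T ‖F‖ ≤ Φ`. Then `‖g 0‖ (1 − e^{−L₀}) ≤ f₁/λ + e^{−L₀} Φ`: the value at the base point is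
controlled by the forcing alone — on the initial stretch through the steepness `λ` of the exponent, beyond it through the suppression
`e^{−L₀}` — because the homogeneous part returns multiplied by the monodromy factor `e^{−A T}` with `|e^{−A T}| ≤ e^{−L₀}`. [folklore] -/
theorem norm_base_le_of_loop {T s₁ lam f₁ L₀ Φ : ℝ} {g a F A : ℝ → ℂ} {v : ℝ → ℝ} (hT : 0 ≤ T)
    (hg : ∀ σ ∈ Icc 0 T, HasDerivAt g (a σ * g σ + F σ) σ) (hA : ∀ σ ∈ Icc 0 T, HasDerivAt A (a σ) σ)
    (hac : ContinuousOn a (Icc 0 T)) (hF : ContinuousOn F (Icc 0 T)) (hA0 : A 0 = 0) (hloop : g T = g 0)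
    (ha : ∀ σ ∈ Icc 0 T, 0 ≤ (a σ).re) (hs₁ : s₁ ∈ Icc 0 T) (hlam : 0 < lam) (hf₁ : 0 ≤ f₁)
    (hv : ∀ σ ∈ Icc 0 s₁, lam * v σ ≤ (a σ).re) (hFv : ∀ σ ∈ Icc 0 s₁, ‖F σ‖ ≤ f₁ * v σ) (hL₀ : L₀ ≤ (A s₁).re)
    (hΦ : ∫ σ in s₁..T, ‖F σ‖ ≤ Φ) :
    ‖g 0‖ * (1 - Real.exp (-L₀)) ≤ f₁ / lam + Real.exp (-L₀) * Φ := by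
  have hmono := monotoneOn_re_primitive hA ha
  have h0T : (0 : ℝ) ∈ Icc 0 T := ⟨le_rfl, hT⟩
  have hTT : T ∈ Icc 0 T := ⟨hT, le_rfl⟩
  have hAc : ContinuousOn A (Icc 0 T) := fun τ hτ => (hA τ hτ).continuousAt.continuousWithinAt
  have hexpc : ContinuousOn (fun σ => Real.exp (-(A σ).re)) (Icc 0 T) := (Complex.continuous_re.comp_continuousOn hAc).neg.rexp
  -- the identity over the whole loop: `g 0 (e^{−A T} − 1) = ∫₀^T e^{−A} F`
  have hid0 := intFactor_identity hg hA hF le_rfl hT le_rfl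
  rw [hloop, hA0, neg_zero, Complex.exp_zero, one_mul] at hid0
  have hid : (Complex.exp (-A T) - 1) * g 0 = ∫ τ in (0 : ℝ)..T, Complex.exp (-A τ) * F τ := by
    rw [← hid0]; ring
  -- lower bound for the monodromy defect
  have hdef : 1 - Real.exp (-L₀) ≤ ‖Complex.exp (-A T) - 1‖ := by
    have h1 : ‖Complex.exp (-A T)‖ ≤ Real.exp (-L₀) := by
      rw [Complex.norm_exp, Complex.neg_re, Real.exp_le_exp, neg_le_neg_iff]
      exact hL₀.trans (hmono hs₁ hTT hs₁.2)
    have := norm_sub_norm_le (1 : ℂ) (Complex.exp (-A T))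
    rw [norm_one, norm_sub_rev] at this
    linarith
  -- upper bound for the forcing integral
  have hnorm : ‖∫ τ in (0 : ℝ)..T, Complex.exp (-A τ) * F τ‖ ≤ ∫ τ in (0 : ℝ)..T, Real.exp (-(A τ).re) * ‖F τ‖ := by
    refine (intervalIntegral.norm_integral_le_integral_norm hT).trans_eq ?_
    congr 1; funext τ
    rw [norm_mul, Complex.norm_exp, Complex.neg_re]
  have hprod : ContinuousOn (fun σ => Real.exp (-(A σ).re) * ‖F σ‖) (Icc 0 T) := hexpc.mul hF.norm
  have hii : ∀ {c d : ℝ}, 0 ≤ c → c ≤ d → d ≤ T → IntervalIntegrable (fun σ => Real.exp (-(A σ).re) * ‖F σ‖) volume c d :=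
    fun hc hcd hd => (hprod.mono (by rw [uIcc_of_le hcd]; exact Icc_subset_Icc hc hd)).intervalIntegrable
  have hsplit : ∫ τ in (0 : ℝ)..T, Real.exp (-(A τ).re) * ‖F τ‖ =
      (∫ τ in (0 : ℝ)..s₁, Real.exp (-(A τ).re) * ‖F τ‖) + ∫ τ in s₁..T, Real.exp (-(A τ).re) * ‖F τ‖ :=
    (integral_add_adjacent_intervals (hii le_rfl hs₁.1 hs₁.2) (hii hs₁.1 hs₁.2 le_rfl)).symm
  have hI1 : ∫ σ in (0 : ℝ)..s₁, Real.exp (-(A σ).re) * ‖F σ‖ ≤ f₁ / lam := by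
    refine (integral_steep_le hA hac hF hs₁ hlam hf₁ hv hFv).trans ?_
    rw [hA0, Complex.zero_re, neg_zero, Real.exp_zero]
    have : 0 ≤ Real.exp (-(A s₁).re) := (Real.exp_pos _).le
    have hfl : 0 ≤ f₁ / lam := div_nonneg hf₁ hlam.le
    nlinarith
  have hI2 : ∫ σ in s₁..T, Real.exp (-(A σ).re) * ‖F σ‖ ≤ Real.exp (-L₀) * Φ := by
    have hle : ∀ σ ∈ Icc s₁ T, Real.exp (-(A σ).re) * ‖F σ‖ ≤ Real.exp (-L₀) * ‖F σ‖ := by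
      intro σ hσ
      refine mul_le_mul_of_nonneg_right ?_ (norm_nonneg _)
      rw [Real.exp_le_exp, neg_le_neg_iff]
      exact hL₀.trans (hmono hs₁ ⟨hs₁.1.trans hσ.1, hσ.2⟩ hσ.1)
    have hFi : IntervalIntegrable (fun σ => Real.exp (-L₀) * ‖F σ‖) volume s₁ T :=
      ((hF.norm.mono (by rw [uIcc_of_le hs₁.2]; exact Icc_subset_Icc hs₁.1 le_rfl)).intervalIntegrable).const_mul _
    calc ∫ σ in s₁..T, Real.exp (-(A σ).re) * ‖F σ‖ ≤ ∫ σ in s₁..T, Real.exp (-L₀) * ‖F σ‖ :=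
          integral_mono_on hs₁.2 (hii hs₁.1 hs₁.2 le_rfl) hFi hle
      _ = Real.exp (-L₀) * ∫ σ in s₁..T, ‖F σ‖ := intervalIntegral.integral_const_mul _ _
      _ ≤ Real.exp (-L₀) * Φ := mul_le_mul_of_nonneg_left hΦ (Real.exp_pos _).le
  -- assemble
  have key : ‖g 0‖ * ‖Complex.exp (-A T) - 1‖ ≤ f₁ / lam + Real.exp (-L₀) * Φ := by
    rw [mul_comm, ← norm_mul, hid]
    linarith [hnorm]
  calc ‖g 0‖ * (1 - Real.exp (-L₀)) ≤ ‖g 0‖ * ‖Complex.exp (-A T) - 1‖ := mul_le_mul_of_nonneg_left hdef (norm_nonneg _)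
    _ ≤ f₁ / lam + Real.exp (-L₀) * Φ := key

/-- **Transport in the contracting direction.** Under the loop condition and `Re a ≥ 0`, for every `σ ∈ [0, T]`:
`‖g σ‖ ≤ ‖g 0‖ + ∫_σ^T ‖F‖` (represent `g σ` through `g T = g 0` forward along the loop, where the kernel
`e^{A σ − A τ}`, `τ ≥ σ`, has modulus `≤ 1`). [folklore] -/
theorem norm_le_base_add_of_loop {T : ℝ} {g a F A : ℝ → ℂ} (hg : ∀ σ ∈ Icc 0 T, HasDerivAt g (a σ * g σ + F σ) σ)
    (hA : ∀ σ ∈ Icc 0 T, HasDerivAt A (a σ) σ) (hF : ContinuousOn F (Icc 0 T)) (hloop : g T = g 0)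
    (ha : ∀ σ ∈ Icc 0 T, 0 ≤ (a σ).re) {σ : ℝ} (hσ : σ ∈ Icc 0 T) :
    ‖g σ‖ ≤ ‖g 0‖ + ∫ τ in σ..T, ‖F τ‖ := by
  have hmono := monotoneOn_re_primitive hA ha
  have hTT : T ∈ Icc 0 T := ⟨hσ.1.trans hσ.2, le_rfl⟩
  have hAc : ContinuousOn A (Icc 0 T) := fun τ hτ => (hA τ hτ).continuousAt.continuousWithinAt
  have hid := intFactor_identity hg hA hF hσ.1 hσ.2 le_rfl
  rw [hloop] at hid
  -- `g σ = e^{A σ} (e^{−A T} g 0 − ∫_σ^T e^{−A} F)`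
  have hg' : g σ = Complex.exp (A σ) * (Complex.exp (-A T) * g 0 - ∫ τ in σ..T, Complex.exp (-A τ) * F τ) := by
    rw [← hid]
    have : Complex.exp (A σ) * Complex.exp (-A σ) = 1 := by rw [← Complex.exp_add, add_neg_cancel, Complex.exp_zero]
    linear_combination (-(g σ)) * this
  have hsub : uIcc σ T ⊆ Icc 0 T := by rw [uIcc_of_le hσ.2]; exact Icc_subset_Icc hσ.1 le_rfl
  have h1 : ‖Complex.exp (A σ) * (Complex.exp (-A T) * g 0)‖ ≤ ‖g 0‖ := by
    rw [← mul_assoc, ← Complex.exp_add, norm_mul, Complex.norm_exp, Complex.add_re, Complex.neg_re]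
    have : Real.exp ((A σ).re + -(A T).re) ≤ 1 := by
      rw [Real.exp_le_one_iff]; linarith [hmono hσ hTT hσ.2]
    exact (mul_le_mul_of_nonneg_right this (norm_nonneg _)).trans_eq (one_mul _)
  have h2 : ‖Complex.exp (A σ) * ∫ τ in σ..T, Complex.exp (-A τ) * F τ‖ ≤ ∫ τ in σ..T, ‖F τ‖ := by
    rw [← intervalIntegral.integral_const_mul]
    refine (intervalIntegral.norm_integral_le_integral_norm hσ.2).trans (integral_mono_on hσ.2 ?_ ?_ fun τ hτ => ?_)
    · exact ((continuousOn_const.mul (((hAc.mono hsub).neg.cexp).mul (hF.mono hsub))).norm).intervalIntegrable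
    · exact (hF.mono hsub).norm.intervalIntegrable
    · rw [← mul_assoc, ← Complex.exp_add, norm_mul, Complex.norm_exp, Complex.add_re, Complex.neg_re]
      have : Real.exp ((A σ).re + -(A τ).re) ≤ 1 := by
        rw [Real.exp_le_one_iff]; linarith [hmono hσ ⟨hσ.1.trans hτ.1, hτ.2⟩ hτ.1]
      exact (mul_le_mul_of_nonneg_right this (norm_nonneg _)).trans_eq (one_mul _)
  calc ‖g σ‖ = ‖Complex.exp (A σ) * (Complex.exp (-A T) * g 0) - Complex.exp (A σ) * ∫ τ in σ..T, Complex.exp (-A τ) * F τ‖ := by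
        rw [hg', mul_sub]
    _ ≤ ‖g 0‖ + ∫ τ in σ..T, ‖F τ‖ := (norm_sub_le _ _).trans (add_le_add h1 h2)

/-! ## The slow component and the combined estimate -/

/-- **The slow component moves little.** If `υ′ = α (g + ρ υ)` on `[0, T]` with `‖g‖ ≤ Γ`, `‖ρ‖ ≤ ϱ`, `‖υ‖ ≤ U` there, then
`‖υ σ − υ 0‖ ≤ (Γ + ϱ U) ∫₀^T ‖α‖` for every `σ ∈ [0, T]`. [folklore] -/
theorem norm_sub_le_of_slow {T Γ ϱ U : ℝ} {g υ α ρ : ℝ → ℂ} (hυ : ∀ σ ∈ Icc 0 T, HasDerivAt υ (α σ * (g σ + ρ σ * υ σ)) σ)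
    (hα : ContinuousOn α (Icc 0 T)) (hg : ContinuousOn g (Icc 0 T)) (hρ : ContinuousOn ρ (Icc 0 T))
    (hΓ : ∀ σ ∈ Icc 0 T, ‖g σ‖ ≤ Γ) (hϱ : ∀ σ ∈ Icc 0 T, ‖ρ σ‖ ≤ ϱ) (hU : ∀ σ ∈ Icc 0 T, ‖υ σ‖ ≤ U) {σ : ℝ}
    (hσ : σ ∈ Icc 0 T) : ‖υ σ - υ 0‖ ≤ (Γ + ϱ * U) * ∫ τ in (0 : ℝ)..T, ‖α τ‖ := by
  have hυc : ContinuousOn υ (Icc 0 T) := fun τ hτ => (hυ τ hτ).continuousAt.continuousWithinAt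
  have hsub : uIcc 0 σ ⊆ Icc 0 T := by rw [uIcc_of_le hσ.1]; exact Icc_subset_Icc le_rfl hσ.2
  have hrhs : ContinuousOn (fun τ => α τ * (g τ + ρ τ * υ τ)) (Icc 0 T) := hα.mul (hg.add (hρ.mul hυc))
  have hftc := integral_eq_sub_of_hasDerivAt (fun τ hτ => hυ τ (hsub hτ)) ((hrhs.mono hsub).intervalIntegrable)
  have hΓ0 : 0 ≤ Γ := (norm_nonneg _).trans (hΓ 0 ⟨le_rfl, hσ.1.trans hσ.2⟩)
  have hU0 : 0 ≤ U := (norm_nonneg _).trans (hU 0 ⟨le_rfl, hσ.1.trans hσ.2⟩)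
  have hϱ0 : 0 ≤ ϱ := (norm_nonneg _).trans (hϱ 0 ⟨le_rfl, hσ.1.trans hσ.2⟩)
  have hle : ∀ τ ∈ Icc 0 σ, ‖α τ * (g τ + ρ τ * υ τ)‖ ≤ (Γ + ϱ * U) * ‖α τ‖ := by
    intro τ hτ
    have hτ' : τ ∈ Icc 0 T := ⟨hτ.1, hτ.2.trans hσ.2⟩
    rw [norm_mul, mul_comm]
    refine mul_le_mul_of_nonneg_right ((norm_add_le _ _).trans (add_le_add (hΓ τ hτ') ?_)) (norm_nonneg _)
    rw [norm_mul]
    exact mul_le_mul (hϱ τ hτ') (hU τ hτ') (norm_nonneg _) hϱ0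
  rw [← hftc]
  calc ‖∫ τ in (0 : ℝ)..σ, α τ * (g τ + ρ τ * υ τ)‖ ≤ ∫ τ in (0 : ℝ)..σ, ‖α τ * (g τ + ρ τ * υ τ)‖ :=
        intervalIntegral.norm_integral_le_integral_norm hσ.1
    _ ≤ ∫ τ in (0 : ℝ)..σ, (Γ + ϱ * U) * ‖α τ‖ :=
        integral_mono_on hσ.1 ((hrhs.mono hsub).norm.intervalIntegrable)
          (((hα.mono hsub).norm.intervalIntegrable).const_mul _) hle
    _ = (Γ + ϱ * U) * ∫ τ in (0 : ℝ)..σ, ‖α τ‖ := intervalIntegral.integral_const_mul _ _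
    _ ≤ (Γ + ϱ * U) * ∫ τ in (0 : ℝ)..T, ‖α τ‖ := by
        refine mul_le_mul_of_nonneg_left ?_ (by positivity)
        exact integral_mono_interval le_rfl hσ.1 hσ.2 (Eventually.of_forall fun τ => norm_nonneg _)
          ((hα.norm.mono (by rw [uIcc_of_le (hσ.1.trans hσ.2)])).intervalIntegrable)

/-- **THE COMBINED LOOP SLAVING ESTIMATE.** Let, on `[0, T]`, `g′ = a g − f υ` and `υ′ = α (g + ρ υ)` (all coefficients
continuous), `A′ = a`, `A 0 = 0`, with the loop condition `g T = g 0`, `Re a ≥ 0`, the steep initial stretch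
(`Re a ≥ λ v`, `‖f‖ ≤ f₁ v` on `[0, s₁]`, `L₀ ≤ Re A(s₁)`, `0 < L₀`), and the budgets `∫_{s₁}^T ‖f‖ ≤ Φ`, `∫₀^T ‖f‖ ≤ Φ'`,
`∫₀^T ‖α‖ ≤ Aα`, `‖ρ‖ ≤ ϱ`. Put `c₁ = (f₁/λ + e^{−L₀} Φ)/(1 − e^{−L₀})` and `κ = Aα (c₁ + Φ' + ϱ)`. Then
`‖g 0‖ (1 − κ) ≤ c₁ ‖υ 0‖` — for `κ < 1` the fast component at the base point is slaved to the slow one with constant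
`c₁/(1 − κ)`, using nothing about the particular solution except that it closes up along the loop. [folklore] -/
theorem loop_slaving_estimate {T s₁ lam f₁ L₀ Φ Φ' Aα ϱ : ℝ} {g υ a f α ρ A : ℝ → ℂ} {v : ℝ → ℝ} (hT : 0 ≤ T)
    (hg : ∀ σ ∈ Icc 0 T, HasDerivAt g (a σ * g σ - f σ * υ σ) σ)
    (hυ : ∀ σ ∈ Icc 0 T, HasDerivAt υ (α σ * (g σ + ρ σ * υ σ)) σ) (hA : ∀ σ ∈ Icc 0 T, HasDerivAt A (a σ) σ)
    (hac : ContinuousOn a (Icc 0 T)) (hfc : ContinuousOn f (Icc 0 T)) (hαc : ContinuousOn α (Icc 0 T))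
    (hρc : ContinuousOn ρ (Icc 0 T)) (hA0 : A 0 = 0) (hloop : g T = g 0) (ha : ∀ σ ∈ Icc 0 T, 0 ≤ (a σ).re)
    (hs₁ : s₁ ∈ Icc 0 T) (hlam : 0 < lam) (hf₁ : 0 ≤ f₁) (hv : ∀ σ ∈ Icc 0 s₁, lam * v σ ≤ (a σ).re)
    (hfv : ∀ σ ∈ Icc 0 s₁, ‖f σ‖ ≤ f₁ * v σ) (hL₀ : L₀ ≤ (A s₁).re) (hL₀pos : 0 < L₀) (hΦ : ∫ σ in s₁..T, ‖f σ‖ ≤ Φ)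
    (hΦ' : ∫ σ in (0 : ℝ)..T, ‖f σ‖ ≤ Φ') (hAα : ∫ σ in (0 : ℝ)..T, ‖α σ‖ ≤ Aα) (hϱ : ∀ σ ∈ Icc 0 T, ‖ρ σ‖ ≤ ϱ) :
    ‖g 0‖ * (1 - Aα * ((f₁ / lam + Real.exp (-L₀) * Φ) / (1 - Real.exp (-L₀)) + Φ' + ϱ)) ≤
      (f₁ / lam + Real.exp (-L₀) * Φ) / (1 - Real.exp (-L₀)) * ‖υ 0‖ := by
  -- the maximum `U` of `‖υ‖` on the loop
  have hυc : ContinuousOn υ (Icc 0 T) := fun τ hτ => (hυ τ hτ).continuousAt.continuousWithinAt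
  have hgc : ContinuousOn g (Icc 0 T) := fun τ hτ => (hg τ hτ).continuousAt.continuousWithinAt
  have h0T : (0 : ℝ) ∈ Icc 0 T := ⟨le_rfl, hT⟩
  obtain ⟨σm, hσm, hmax⟩ := (isCompact_Icc (a := (0 : ℝ)) (b := T)).exists_isMaxOn ⟨0, h0T⟩ hυc.norm
  set U : ℝ := ‖υ σm‖ with hUdef
  have hU : ∀ σ ∈ Icc 0 T, ‖υ σ‖ ≤ U := fun σ hσ => hmax hσ
  have hU0 : 0 ≤ U := norm_nonneg _
  -- constants
  set c₀ : ℝ := f₁ / lam + Real.exp (-L₀) * Φ with hc₀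
  have hden : 0 < 1 - Real.exp (-L₀) := by
    have : Real.exp (-L₀) < 1 := by rw [Real.exp_lt_one_iff]; linarith
    linarith
  have hΦ0 : 0 ≤ Φ := le_trans (intervalIntegral.integral_nonneg hs₁.2 fun σ _ => norm_nonneg _) hΦ
  have hΦ'0 : 0 ≤ Φ' := le_trans (intervalIntegral.integral_nonneg hT fun σ _ => norm_nonneg _) hΦ'
  have hAα0 : 0 ≤ Aα := le_trans (intervalIntegral.integral_nonneg hT fun σ _ => norm_nonneg _) hAα
  have hc₀0 : 0 ≤ c₀ := by positivity
  -- (1) the loop estimate for `g 0`, with forcing `F = −f υ`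
  have hF : ContinuousOn (fun σ => -(f σ * υ σ)) (Icc 0 T) := (hfc.mul hυc).neg
  have hg' : ∀ σ ∈ Icc 0 T, HasDerivAt g (a σ * g σ + -(f σ * υ σ)) σ := fun σ hσ => by
    simpa [sub_eq_add_neg] using hg σ hσ
  have hFv : ∀ σ ∈ Icc 0 s₁, ‖-(f σ * υ σ)‖ ≤ f₁ * U * v σ := by
    intro σ hσ
    have hσT : σ ∈ Icc 0 T := ⟨hσ.1, hσ.2.trans hs₁.2⟩
    have hvσ : 0 ≤ f₁ * v σ := (norm_nonneg _).trans (hfv σ hσ)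
    rw [norm_neg, norm_mul]
    calc ‖f σ‖ * ‖υ σ‖ ≤ f₁ * v σ * U := mul_le_mul (hfv σ hσ) (hU σ hσT) (norm_nonneg _) hvσ
      _ = f₁ * U * v σ := by ring
  have hΦU : ∫ σ in s₁..T, ‖-(f σ * υ σ)‖ ≤ Φ * U := by
    have hsub : uIcc s₁ T ⊆ Icc 0 T := by rw [uIcc_of_le hs₁.2]; exact Icc_subset_Icc hs₁.1 le_rfl
    calc ∫ σ in s₁..T, ‖-(f σ * υ σ)‖ ≤ ∫ σ in s₁..T, ‖f σ‖ * U := by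
          refine integral_mono_on hs₁.2 ((hF.mono hsub).norm.intervalIntegrable)
            (((hfc.mono hsub).norm.intervalIntegrable).mul_const _) fun σ hσ => ?_
          rw [norm_neg, norm_mul]
          exact mul_le_mul_of_nonneg_left (hU σ ⟨hs₁.1.trans hσ.1, hσ.2⟩) (norm_nonneg _)
      _ = (∫ σ in s₁..T, ‖f σ‖) * U := intervalIntegral.integral_mul_const _ _
      _ ≤ Φ * U := mul_le_mul_of_nonneg_right hΦ hU0
  have h1 := norm_base_le_of_loop hT hg' hA hac hF hA0 hloop ha hs₁ hlam (mul_nonneg hf₁ hU0) hv hFv hL₀ hΦU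
  have hg0 : ‖g 0‖ ≤ c₀ / (1 - Real.exp (-L₀)) * U := by
    rw [div_mul_eq_mul_div, le_div_iff₀ hden, hc₀]
    calc ‖g 0‖ * (1 - Real.exp (-L₀)) ≤ f₁ * U / lam + Real.exp (-L₀) * (Φ * U) := h1
      _ = (f₁ / lam + Real.exp (-L₀) * Φ) * U := by ring
  -- (2) the bound for `g` along the loop
  have hΓ : ∀ σ ∈ Icc 0 T, ‖g σ‖ ≤ c₀ / (1 - Real.exp (-L₀)) * U + Φ' * U := by
    intro σ hσ
    have h2 := norm_le_base_add_of_loop hg' hA hF hloop ha hσ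
    have hsub : uIcc σ T ⊆ Icc 0 T := by rw [uIcc_of_le hσ.2]; exact Icc_subset_Icc hσ.1 le_rfl
    have h3 : ∫ τ in σ..T, ‖-(f τ * υ τ)‖ ≤ Φ' * U := by
      calc ∫ τ in σ..T, ‖-(f τ * υ τ)‖ ≤ ∫ τ in σ..T, ‖f τ‖ * U := by
            refine integral_mono_on hσ.2 ((hF.mono hsub).norm.intervalIntegrable)
              (((hfc.mono hsub).norm.intervalIntegrable).mul_const _) fun τ hτ => ?_
            rw [norm_neg, norm_mul]
            exact mul_le_mul_of_nonneg_left (hU τ ⟨hσ.1.trans hτ.1, hτ.2⟩) (norm_nonneg _)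
        _ = (∫ τ in σ..T, ‖f τ‖) * U := intervalIntegral.integral_mul_const _ _
        _ ≤ (∫ τ in (0 : ℝ)..T, ‖f τ‖) * U := by
            refine mul_le_mul_of_nonneg_right ?_ hU0
            exact integral_mono_interval hσ.1 hσ.2 le_rfl (Eventually.of_forall fun τ => norm_nonneg _)
              ((hfc.norm.mono (by rw [uIcc_of_le hT])).intervalIntegrable)
        _ ≤ Φ' * U := mul_le_mul_of_nonneg_right hΦ' hU0
    linarith
  -- (3) the slow component at the maximum point
  have h3 := norm_sub_le_of_slow hυ hαc hgc hρc hΓ hϱ hU hσm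
  have hUle : U ≤ ‖υ 0‖ + (c₀ / (1 - Real.exp (-L₀)) * U + Φ' * U + ϱ * U) * Aα := by
    have : ‖υ σm‖ ≤ ‖υ 0‖ + ‖υ σm - υ 0‖ := by
      have := norm_add_le (υ 0) (υ σm - υ 0); rwa [add_sub_cancel] at this
    have hpos : 0 ≤ c₀ / (1 - Real.exp (-L₀)) * U + Φ' * U + ϱ * U := by
      have hϱ0 : 0 ≤ ϱ := (norm_nonneg _).trans (hϱ 0 h0T)
      positivity
    calc U = ‖υ σm‖ := hUdef
      _ ≤ ‖υ 0‖ + ‖υ σm - υ 0‖ := this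
      _ ≤ ‖υ 0‖ + (c₀ / (1 - Real.exp (-L₀)) * U + Φ' * U + ϱ * U) * ∫ τ in (0 : ℝ)..T, ‖α τ‖ := by linarith
      _ ≤ ‖υ 0‖ + (c₀ / (1 - Real.exp (-L₀)) * U + Φ' * U + ϱ * U) * Aα := by
          linarith [mul_le_mul_of_nonneg_left hAα hpos]
  -- assemble: `‖g 0‖ ≤ c₁ U` and `U (1 − κ) ≤ ‖υ 0‖`
  have hc₁0 : 0 ≤ c₀ / (1 - Real.exp (-L₀)) := div_nonneg hc₀0 hden.le
  have hκU : U * (1 - Aα * (c₀ / (1 - Real.exp (-L₀)) + Φ' + ϱ)) ≤ ‖υ 0‖ := by nlinarith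
  calc ‖g 0‖ * (1 - Aα * (c₀ / (1 - Real.exp (-L₀)) + Φ' + ϱ))
      ≤ ‖g 0‖ * 1 - ‖g 0‖ * (Aα * (c₀ / (1 - Real.exp (-L₀)) + Φ' + ϱ)) := by ring_nf; rfl
    _ ≤ c₀ / (1 - Real.exp (-L₀)) * ‖υ 0‖ := by
        by_cases hκ : Aα * (c₀ / (1 - Real.exp (-L₀)) + Φ' + ϱ) ≤ 1
        · have := mul_le_mul_of_nonneg_left hκU hc₁0
          nlinarith [mul_le_mul_of_nonneg_right hg0 (sub_nonneg.2 hκ)]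
        · push Not at hκ
          have h1' : ‖g 0‖ * 1 - ‖g 0‖ * (Aα * (c₀ / (1 - Real.exp (-L₀)) + Φ' + ϱ)) ≤ 0 := by
            nlinarith [norm_nonneg (g 0)]
          exact h1'.trans (mul_nonneg hc₁0 (norm_nonneg _))

end Literature.Analysis.ODE

end
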